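import Mathlib
import Summits.QuantumFields.YangMills.Theorems.BalabanUVNodesN15VectorCarrier
import Summits.QuantumFields.YangMills.Theorems.BalabanUVNodesN15MatrixCoefficient
import HarnessLib

/-!
# Route «BalabanUVNodes» (cluster K4 «SpineRates»), Track-A DAG node N15 = spine estimate NE2, BACKGROUND LAYER — FIRST MISSING
# ESTIMATE, part 16: THE BASIS DICTIONARY — operator-norm letters (parts 13a–13c, `C = Φ(η, ad_A)` in an abstract normed algebra `𝔄`) versus
# max-row-sum letters (part 14, matrix coefficients on `ℝ^ι` with the `ℓ^∞` norm): in coordinates `e : 𝔄 ≃L[ℝ] ℝ^ι` every row sum of the matrix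
# of `T` is `≤ ‖e‖‖e⁻¹‖·‖T‖` (and `ℓ^∞ → ℓ^∞` operator norm ≤ max row sum, exactly), so the print's coefficients in coordinates satisfy part 14's
# binders with ONE basis constant `κ = ‖e‖‖e⁻¹‖`; the two multiplication operators agree under uncurrying `X → ℝ^ι ≅ X × ι → ℝ`

Cell `pub-ymgap`, seat `pub-ymgap-dag-n15-b` (generation g3; FIRST-MISSING-ESTIMATE, HUMAN RULING D-0062; chair R424 venue; ROSTER-D0062
l.26).  `bears_on: R4∕N15`.  Filed `--supports stmt-QuantumFields-19351`.  Answers the referee's PIN «N15 basis-dictionary» (ref-B g6 READ-318 on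
p434671, INBOX 2026-08-26T09:24Z): *«parts 13a–c measure `C = Φ(η, ad_A)` in the OPERATOR norm of an abstract `𝔄`, part 14 measures matrix
coefficients by MAX ROW SUMS on `ℝ^ι` with ℓ^∞ — the two letter systems are NOT yet joined for the print's coefficients (costs only a basis
norm-equivalence constant; `‖·‖_{ℓ^∞→ℓ^∞}` = max row sum is exact)»*.  This file types exactly that join.

WHY.  The print's coefficients of (3.50)–(3.52) ([Balaban1985BackgroundPropagators] p. 400) are operators on `𝔤`; parts 13a–c bound their η-pairing
fit in the operator norm of `𝔤 →L[ℝ] 𝔤` for any complete normed algebra structure carrying `𝔤`, part 14 feeds MATRIX coefficients with max-row-sum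
letters into the first-order sandwich on the product carrier `X × ι`.  A coordinate system `e : 𝔄 ≃L[ℝ] (ι → ℝ)` (a basis of the finite-dimensional
`𝔤`, with the `ℓ^∞` norm on coordinates) turns one into the other: the matrix of `T` in coordinates is that of `e ∘ T ∘ e⁻¹` on `ℝ^ι`, each of whose
row sums is at most its `ℓ^∞ → ℓ^∞` operator norm `≤ ‖e‖·‖T‖·‖e⁻¹‖`.  THE PRINT USED (SHAPES only): (3.35) p. 396, (3.50)–(3.52) p. 400.  Nothing of [B9]
asserted.

CONTENTS (all [folklore]: finite-dimensional linear algebra; parts 13b∕13c∕14 BY NAME).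
* §1 `ℝ^ι` WITH THE `ℓ^∞` NORM: `apply_eq_sum_toMatrix'` (`S v i = Σ_j M_{ij} v_j`), `row_abs_sum_le_opNorm` (EACH ROW SUM `Σ_j |M_{ij}| ≤ ‖S‖`, sign
  vector), `opNorm_le_of_row_abs_sum_le` (conversely `‖S‖ ≤ R` if all row sums are `≤ R`: the `ℓ^∞ → ℓ^∞` norm IS the max row sum).
* §2 COORDINATES `e : 𝔄 ≃L[ℝ] (ι → ℝ)`: `coordMat e T` (the matrix of `T : 𝔄 →L[ℝ] 𝔄` in coordinates), `coordMat_sub`, `row_abs_sum_coordMat_le`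
  (`Σ_j |coordMat e T _{ij}| ≤ κ_e·‖T‖`, `κ_e = ‖e‖‖e⁻¹‖` = `basisConst e`), `basisConst_nonneg`.
* §3 THE JOIN: `rowBound_of_opNormBound` (letter `α`), `rowFit_of_opNormFit` (the fit: part 13b∕13c's `‖C′(x′) − C(πx′)‖ ≤ o` ⟹ part 14's
  `Σ_j |coordMat(C′x′)_{ij} − coordMat(C(πx′))_{ij}| ≤ κ_e·o`), `hasMaj_idef_mmulOp_of_opNormFit` (part 14's `hasMaj_idef_mmulOp` with the operator-norm fit as
  hypothesis), **`hasMaj_idef_transporter_coords`** (END TO END: the print's transporter coefficient `Phi1(η, ad_{A(b)})` IN COORDINATES on the product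
  carrier — 13b's `fit_Phi1_ad` ∘ `rowFit_of_opNormFit` ∘ 14's `hasMaj_idef_mmulOp`: diagonal block majorant `diagK (κ_e(2e·o + 2e(2r)²η))`),
  `hasMaj_idef_secondOrderCoeff_coords` (the same for `F′_{1,k}`).
* §4 UNCURRYING `X → ℝ^ι ≅ X × ι → ℝ` (`E = ι → ℝ` itself, `κ = 1`): `uncurry_emulOp` (13c's `emulOp C` IS 14's `mmulOp (toMatrix' ∘ C)`), `uncurry_pullV`,
  `isLoc_supSize_iff_isLoc_ofBlocks`, `loc_ofBlocks_uncurry_le` ∕ `loc_supSize_le_loc_ofBlocks` (the sharp sup size of 13c and the sharp block norm of 14 have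
  THE SAME local sizes), `hasMaj_ofBlocks_iff_hasMaj_supSize` (majorants transfer both ways).

HONEST FRAMING ∕ LIMITS.  Pure finite-dimensional bookkeeping; `κ_e` depends on the chosen coordinates (for an `ℓ^∞`-isometric basis `κ_e = 1`); nothing
about which norm Bałaban's `O(1)` constants refer to is decided here.  NE2⁺ NOT PRINTED, NOT proved; count-neutral (typed 28∕28; nothing discharged); one
finite T⁴ at fixed ε — NOT infinite volume, NOT OS on ℝ⁴, NOT a mass gap, NOT Clay.
-/

noncomputable section

namespace Summit.QuantumFields.YangMills.BalabanUVNodes.N15.MatrixSpecies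

open Literature.MathematicalPhysics.QuantumFieldTheory.Balaban1983to89
open Literature.MathematicalPhysics.QuantumFieldTheory.Balaban1983to89.T4EtaRateDefect (idef idef_apply)
open Literature.MathematicalPhysics.QuantumFieldTheory.Balaban1983to89.T4EtaRateCoeffDefect (pull pull_apply diagK diagK_nonneg fibre mem_fibre)
open Literature.MathematicalPhysics.QuantumFieldTheory.Balaban1983to89.B11AxialTransport190 (abs_le_loc_ofBlocks loc_ofBlocks_le)
open Literature.MathematicalPhysics.QuantumFieldTheory.Balaban1983to89.Beta.AveragingCorrectionJets (adCLM)
open B11SectG B11SupSize190 Finset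

/-! ## §1 `ℝ^ι` with the `ℓ^∞` norm: row sums versus the operator norm -/

section Linfty

variable {ι : Type} [Fintype ι] [DecidableEq ι]

/-- Matrix form of a linear map on `ℝ^ι`: `S v i = Σ_j M_{ij}·v_j` with `M = LinearMap.toMatrix' S`. [folklore] -/
theorem apply_eq_sum_toMatrix' (S : (ι → ℝ) →ₗ[ℝ] (ι → ℝ)) (v : ι → ℝ) (i : ι) :
    S v i = ∑ j, LinearMap.toMatrix' S i j * v j := by
  conv_lhs => rw [← Matrix.toLin'_toMatrix' S, Matrix.toLin'_apply]
  simp [Matrix.mulVec, dotProduct]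

/-- EACH ROW SUM IS AT MOST THE `ℓ^∞ → ℓ^∞` OPERATOR NORM: `Σ_j |M_{ij}| ≤ ‖S‖` (test `S` on the sign vector of row `i`). [folklore] -/
theorem row_abs_sum_le_opNorm (S : (ι → ℝ) →L[ℝ] (ι → ℝ)) (i : ι) :
    ∑ j, |LinearMap.toMatrix' (S : (ι → ℝ) →ₗ[ℝ] (ι → ℝ)) i j| ≤ ‖S‖ := by
  set M := LinearMap.toMatrix' (S : (ι → ℝ) →ₗ[ℝ] (ι → ℝ)) with hM
  set ε : ι → ℝ := fun j => if 0 ≤ M i j then 1 else -1 with hε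
  have hε1 : ‖ε‖ ≤ 1 := by
    refine (pi_norm_le_iff_of_nonneg zero_le_one).2 fun j => ?_
    simp only [hε]
    split_ifs <;> simp
  have hrow : ∑ j, |M i j| = S ε i := by
    rw [show S ε = (S : (ι → ℝ) →ₗ[ℝ] (ι → ℝ)) ε from rfl, apply_eq_sum_toMatrix']
    refine Finset.sum_congr rfl fun j _ => ?_
    simp only [hε, ← hM]
    split_ifs with h
    · rw [abs_of_nonneg h, mul_one]
    · rw [abs_of_neg (lt_of_not_ge h)]; ring
  calc ∑ j, |M i j| = S ε i := hrow
    _ ≤ |S ε i| := le_abs_self _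
    _ ≤ ‖S ε‖ := by rw [← Real.norm_eq_abs]; exact norm_le_pi_norm (S ε) i
    _ ≤ ‖S‖ * ‖ε‖ := S.le_opNorm ε
    _ ≤ ‖S‖ := by nlinarith [norm_nonneg S, norm_nonneg ε]

/-- CONVERSELY the operator norm is at most the max row sum: if every row sum is `≤ R` (`R ≥ 0`) then `‖S‖ ≤ R`. [folklore] -/
theorem opNorm_le_of_row_abs_sum_le (S : (ι → ℝ) →L[ℝ] (ι → ℝ)) {R : ℝ} (hR : 0 ≤ R)
    (h : ∀ i, ∑ j, |LinearMap.toMatrix' (S : (ι → ℝ) →ₗ[ℝ] (ι → ℝ)) i j| ≤ R) : ‖S‖ ≤ R := by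
  refine ContinuousLinearMap.opNorm_le_bound S hR fun v => ?_
  refine (pi_norm_le_iff_of_nonneg (mul_nonneg hR (norm_nonneg v))).2 fun i => ?_
  rw [Real.norm_eq_abs, show S v = (S : (ι → ℝ) →ₗ[ℝ] (ι → ℝ)) v from rfl, apply_eq_sum_toMatrix']
  calc |∑ j, LinearMap.toMatrix' (S : (ι → ℝ) →ₗ[ℝ] (ι → ℝ)) i j * v j|
      ≤ ∑ j, |LinearMap.toMatrix' (S : (ι → ℝ) →ₗ[ℝ] (ι → ℝ)) i j * v j| := Finset.abs_sum_le_sum_abs _ _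
    _ ≤ ∑ j, |LinearMap.toMatrix' (S : (ι → ℝ) →ₗ[ℝ] (ι → ℝ)) i j| * ‖v‖ := Finset.sum_le_sum fun j _ => by
        rw [abs_mul]
        exact mul_le_mul_of_nonneg_left (by rw [← Real.norm_eq_abs]; exact norm_le_pi_norm v j) (abs_nonneg _)
    _ = (∑ j, |LinearMap.toMatrix' (S : (ι → ℝ) →ₗ[ℝ] (ι → ℝ)) i j|) * ‖v‖ := by rw [Finset.sum_mul]
    _ ≤ R * ‖v‖ := mul_le_mul_of_nonneg_right (h i) (norm_nonneg v)

end Linfty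

/-! ## §2 Coordinates: the matrix of an operator on `𝔄` in a coordinate system `e : 𝔄 ≃L[ℝ] ℝ^ι`, and the basis constant -/

section Coordinates

variable {ι : Type} [Fintype ι] [DecidableEq ι] {𝔄 : Type} [NormedAddCommGroup 𝔄] [NormedSpace ℝ 𝔄]

/-- THE MATRIX OF `T : 𝔄 →L[ℝ] 𝔄` IN THE COORDINATES `e` (a basis of the finite-dimensional `𝔤` read as a continuous linear equivalence with `ℝ^ι`,
`ℓ^∞` norm on coordinates): the standard matrix of `e ∘ T ∘ e⁻¹`. [folklore] -/
def coordMat (e : 𝔄 ≃L[ℝ] (ι → ℝ)) (T : 𝔄 →L[ℝ] 𝔄) : Matrix ι ι ℝ :=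
  LinearMap.toMatrix'
    ((((e : 𝔄 →L[ℝ] (ι → ℝ)).comp (T.comp (e.symm : (ι → ℝ) →L[ℝ] 𝔄))) : (ι → ℝ) →L[ℝ] (ι → ℝ)) : (ι → ℝ) →ₗ[ℝ] (ι → ℝ))

/-- THE BASIS CONSTANT `κ_e = ‖e‖·‖e⁻¹‖` (the condition number of the coordinate system; `1` for an `ℓ^∞`-isometric basis). [folklore] -/
def basisConst (e : 𝔄 ≃L[ℝ] (ι → ℝ)) : ℝ := ‖(e : 𝔄 →L[ℝ] (ι → ℝ))‖ * ‖(e.symm : (ι → ℝ) →L[ℝ] 𝔄)‖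

omit [DecidableEq ι] in
/-- `0 ≤ κ_e`. [folklore] -/
theorem basisConst_nonneg (e : 𝔄 ≃L[ℝ] (ι → ℝ)) : 0 ≤ basisConst e := mul_nonneg (norm_nonneg _) (norm_nonneg _)

/-- Coordinates are linear in the operator: `coordMat e (T₁ − T₂) = coordMat e T₁ − coordMat e T₂`. [folklore] -/
theorem coordMat_sub (e : 𝔄 ≃L[ℝ] (ι → ℝ)) (T₁ T₂ : 𝔄 →L[ℝ] 𝔄) : coordMat e (T₁ - T₂) = coordMat e T₁ - coordMat e T₂ := by
  unfold coordMat
  rw [← map_sub]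
  congr 1
  ext v i
  simp

/-- **ROW SUMS IN COORDINATES ARE DOMINATED BY THE OPERATOR NORM**: `Σ_j |coordMat e T _{ij}| ≤ κ_e·‖T‖` (§1 for `e ∘ T ∘ e⁻¹`, then
`‖e ∘ T ∘ e⁻¹‖ ≤ ‖e‖‖T‖‖e⁻¹‖`). [folklore] -/
theorem row_abs_sum_coordMat_le (e : 𝔄 ≃L[ℝ] (ι → ℝ)) (T : 𝔄 →L[ℝ] 𝔄) (i : ι) :
    ∑ j, |coordMat e T i j| ≤ basisConst e * ‖T‖ := by
  have h1 := row_abs_sum_le_opNorm ((e : 𝔄 →L[ℝ] (ι → ℝ)).comp (T.comp (e.symm : (ι → ℝ) →L[ℝ] 𝔄))) i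
  have h2 : ‖(e : 𝔄 →L[ℝ] (ι → ℝ)).comp (T.comp (e.symm : (ι → ℝ) →L[ℝ] 𝔄))‖ ≤
      ‖(e : 𝔄 →L[ℝ] (ι → ℝ))‖ * (‖T‖ * ‖(e.symm : (ι → ℝ) →L[ℝ] 𝔄)‖) :=
    (ContinuousLinearMap.opNorm_comp_le _ _).trans
      (mul_le_mul_of_nonneg_left (ContinuousLinearMap.opNorm_comp_le _ _) (norm_nonneg _))
  calc ∑ j, |coordMat e T i j| ≤ _ := h1
    _ ≤ ‖(e : 𝔄 →L[ℝ] (ι → ℝ))‖ * (‖T‖ * ‖(e.symm : (ι → ℝ) →L[ℝ] 𝔄)‖) := h2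
    _ = basisConst e * ‖T‖ := by unfold basisConst; ring

end Coordinates

/-! ## §3 The join: part 13b∕13c's operator-norm letters become part 14's max-row-sum letters in coordinates -/

section Join

variable {ι : Type} [Fintype ι] [DecidableEq ι] {𝔄 : Type} [NormedAddCommGroup 𝔄] [NormedSpace ℝ 𝔄] (e : 𝔄 ≃L[ℝ] (ι → ℝ))
variable {X X' : Type}

/-- LETTER `α` (coefficient size): `‖C x‖ ≤ α` ⟹ every row sum of `coordMat e (C x)` is `≤ κ_e·α`. [folklore] -/
theorem rowBound_of_opNormBound {C : X → (𝔄 →L[ℝ] 𝔄)} {α : ℝ} (hC : ∀ x, ‖C x‖ ≤ α) (x : X) (i : ι) :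
    ∑ j, |coordMat e (C x) i j| ≤ basisConst e * α :=
  (row_abs_sum_coordMat_le e (C x) i).trans (mul_le_mul_of_nonneg_left (hC x) (basisConst_nonneg e))

/-- THE FIT: part 13b∕13c's operator-norm fit `‖C′(x′) − C(πx′)‖ ≤ o(πx′)` ⟹ part 14's max-row-sum fit for the coordinate matrices with `o ↦ κ_e·o`.
[folklore] -/
theorem rowFit_of_opNormFit (π : X' → X) {C' : X' → (𝔄 →L[ℝ] 𝔄)} {C : X → (𝔄 →L[ℝ] 𝔄)} {o : X → ℝ}
    (hfit : ∀ x', ‖C' x' - C (π x')‖ ≤ o (π x')) (x' : X') (i : ι) :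
    ∑ j, |coordMat e (C' x') i j - coordMat e (C (π x')) i j| ≤ basisConst e * o (π x') := by
  have h := row_abs_sum_coordMat_le e (C' x' - C (π x')) i
  rw [coordMat_sub] at h
  exact (h.trans (by rfl)).trans (mul_le_mul_of_nonneg_left (hfit x') (basisConst_nonneg e))

variable [Fintype X] [Fintype X'] {g : B6.Geometry}

/-- PART 14's COEFFICIENT-DEFECT MAJORANT FROM AN OPERATOR-NORM FIT: for operator-valued coefficients `C′, C` with `‖C′(x′) − C(πx′)‖ ≤ o(blk(πx′))`,
the matrix multiplication operators of their coordinate matrices on the product carriers have `𝔇 ≤ diagK (κ_e·o)` (14's `hasMaj_idef_mmulOp`). [folklore] -/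
theorem hasMaj_idef_mmulOp_of_opNormFit (blk : X → g.Site) (π : X' → X) {C' : X' → (𝔄 →L[ℝ] 𝔄)} {C : X → (𝔄 →L[ℝ] 𝔄)}
    {o : g.Site → ℝ} (ho : ∀ y, 0 ≤ o y) (hfit : ∀ x', ‖C' x' - C (π x')‖ ≤ o (blk (π x'))) :
    HasMaj (BlockNorm.ofBlocks g (liftBlk blk ι)) (BlockNorm.ofBlocks g (liftBlk (blk ∘ π) ι))
      (idef (pull (liftMap π ι)) (pull (liftMap π ι)) (mmulOp fun x' => coordMat e (C' x')) (mmulOp fun x => coordMat e (C x)))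
      (diagK fun y => basisConst e * o y) :=
  hasMaj_idef_mmulOp blk π (fun y => mul_nonneg (basisConst_nonneg e) (ho y))
    (rowFit_of_opNormFit e π (o := fun x => o (blk x)) hfit)

variable [NormedRing 𝔄] in
/-- **END TO END IN COORDINATES: THE PRINT's TRANSPORTER COEFFICIENT `η⁻¹(exp(η ad_{A(b)}) − 1)`** — for `𝔄`-valued backgrounds (`𝔄` a complete
real normed algebra with coordinates `e`), `‖A′‖, ‖Ā‖ ≤ r`, regime `η₀(2r) ≤ 1`, `0 ≤ η′ ≤ η ≤ η₀`, blockwise field fit `‖A′(x′) − Ā(πx′)‖ ≤ o(blk(πx′))`: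
the matrix multiplication operators of the COORDINATE MATRICES of `Phi1(η′, ad_{A′})` ∕ `Phi1(η, ad_{Ā})` on the product carriers `X × ι`, `X′ × ι` have the
diagonal block majorant `diagK (κ_e·(2e·o + 2e(2r)²η))` — 13b's `fit_Phi1_ad` → §3 → 14's `hasMaj_idef_mmulOp`: the two letter systems joined. [folklore] -/
theorem hasMaj_idef_transporter_coords {𝔄 : Type} [NormedRing 𝔄] [NormedAlgebra ℝ 𝔄] [CompleteSpace 𝔄] (e : 𝔄 ≃L[ℝ] (ι → ℝ))
    (blk : X → g.Site) (π : X' → X) {η₀ r η η' : ℝ} (hreg : η₀ * (2 * r) ≤ 1) (hη' : 0 ≤ η') (hη'η : η' ≤ η) (hη : η ≤ η₀)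
    {a' : X' → 𝔄} {a : X → 𝔄} (ha' : ∀ x', ‖a' x'‖ ≤ r) (ha : ∀ x, ‖a x‖ ≤ r)
    {o : g.Site → ℝ} (ho : ∀ y, 0 ≤ o y) (hfit : ∀ x', ‖a' x' - a (π x')‖ ≤ o (blk (π x'))) :
    HasMaj (BlockNorm.ofBlocks g (liftBlk blk ι)) (BlockNorm.ofBlocks g (liftBlk (blk ∘ π) ι))
      (idef (pull (liftMap π ι)) (pull (liftMap π ι))
        (mmulOp fun x' => coordMat e (Phi1 η' (adCLM ℝ (a' x'))))
        (mmulOp fun x => coordMat e (Phi1 η (adCLM ℝ (a x)))))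
      (diagK fun y => basisConst e * ((2 * Real.exp 1) * o y + 2 * (Real.exp 1 * (2 * r) ^ 2) * η)) := by
  refine hasMaj_idef_mmulOp_of_opNormFit e blk π (fun y => ?_) fun x' => ?_
  · have : 0 ≤ η := hη'.trans hη'η
    have := ho y
    positivity
  · exact fit_Phi1_ad π hreg hη' hη'η hη ha' ha (o := fun x => o (blk x)) hfit x'

/-- The same for the print's second-order coefficient `F′_{1,k}(ad_{A(b)})` (`0 ≤ r`): `diagK (κ_e·(2e(2r)·o + 2e(2r)³η))`. [folklore] -/
theorem hasMaj_idef_secondOrderCoeff_coords {𝔄 : Type} [NormedRing 𝔄] [NormedAlgebra ℝ 𝔄] [CompleteSpace 𝔄] (e : 𝔄 ≃L[ℝ] (ι → ℝ))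
    (blk : X → g.Site) (π : X' → X) {η₀ r η η' : ℝ} (hreg : η₀ * (2 * r) ≤ 1) (hr : 0 ≤ r) (hη' : 0 ≤ η') (hη'η : η' ≤ η)
    (hη : η ≤ η₀) {a' : X' → 𝔄} {a : X → 𝔄} (ha' : ∀ x', ‖a' x'‖ ≤ r) (ha : ∀ x, ‖a x‖ ≤ r)
    {o : g.Site → ℝ} (ho : ∀ y, 0 ≤ o y) (hfit : ∀ x', ‖a' x' - a (π x')‖ ≤ o (blk (π x'))) :
    HasMaj (BlockNorm.ofBlocks g (liftBlk blk ι)) (BlockNorm.ofBlocks g (liftBlk (blk ∘ π) ι))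
      (idef (pull (liftMap π ι)) (pull (liftMap π ι))
        (mmulOp fun x' => coordMat e (Phi2 η' (adCLM ℝ (a' x'))))
        (mmulOp fun x => coordMat e (Phi2 η (adCLM ℝ (a x)))))
      (diagK fun y => basisConst e * ((2 * (Real.exp 1 * (2 * r))) * o y + 2 * (Real.exp 1 * (2 * r) ^ 3) * η)) := by
  refine hasMaj_idef_mmulOp_of_opNormFit e blk π (fun y => ?_) fun x' => ?_
  · have : 0 ≤ η := hη'.trans hη'η
    have := ho y
    positivity
  · exact fit_Phi2_ad π hreg hr hη' hη'η hη ha' ha (o := fun x => o (blk x)) hfit x'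

end Join

/-! ## §4 Uncurrying `X → ℝ^ι ≅ X × ι → ℝ`: parts 13c and 14 agree for `E = ℝ^ι` (`κ = 1`) -/

section Uncurry

variable {ι : Type} [Fintype ι] {X X' : Type}

/-- 13c's `emulOp C` on `X → ℝ^ι` IS 14's `mmulOp` of the standard matrices on `X × ι → ℝ`:
`(emulOp C f)(x)(i) = (mmulOp (toMatrix' ∘ C) (uncurry f))(x, i)`. [folklore] -/
theorem uncurry_emulOp [DecidableEq ι] (C : X → ((ι → ℝ) →L[ℝ] (ι → ℝ))) (f : X → ι → ℝ) (p : X × ι) :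
    emulOp C f p.1 p.2 = mmulOp (fun x => LinearMap.toMatrix' (C x : (ι → ℝ) →ₗ[ℝ] (ι → ℝ))) (fun q => f q.1 q.2) p := by
  rw [emulOp_apply, mmulOp_apply, show C p.1 (f p.1) = (C p.1 : (ι → ℝ) →ₗ[ℝ] (ι → ℝ)) (f p.1) from rfl,
    apply_eq_sum_toMatrix']

/-- 13c's `pullV π` IS 14's `pull (liftMap π ι)` under uncurrying. [folklore] -/
theorem uncurry_pullV (π : X' → X) (f : X → ι → ℝ) (p : X' × ι) :
    pullV π f p.1 p.2 = pull (liftMap π ι) (fun q : X × ι => f q.1 q.2) p := rfl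

variable [Fintype X] {g : B6.Geometry} [DecidableEq g.Site] (blk : X → g.Site)

/-- LOCALISATION AGREES: `f` vanishes off the block of `y′` iff its uncurrying does. [folklore] -/
theorem isLoc_supSize_iff_isLoc_ofBlocks (y' : g.Site) (f : X → ι → ℝ) :
    (supSize g (fibre blk) blk : BlockNorm g (X → ι → ℝ)).IsLoc y' f ↔
      (BlockNorm.ofBlocks g (liftBlk blk ι)).IsLoc y' (fun q : X × ι => f q.1 q.2) := by
  rw [supSize_isLoc_iff]
  constructor
  · intro h q hq
    exact congr_fun (h q.1 hq) q.2
  · intro h x hx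
    exact funext fun i => h (x, i) hx

/-- THE LOCAL SIZES AGREE (≤): the block sup of `|f(x)(i)|` over `(x, i)` is at most the sharp sup size of `‖f x‖_∞` over the block. [folklore] -/
theorem loc_ofBlocks_uncurry_le (y : g.Site) (f : X → ι → ℝ) :
    (BlockNorm.ofBlocks g (liftBlk blk ι)).loc y (fun q : X × ι => f q.1 q.2) ≤
      (supSize g (fibre blk) blk : BlockNorm g (X → ι → ℝ)).loc y f := by
  refine loc_ofBlocks_le (liftBlk blk ι) _ ((supSize g (fibre blk) blk : BlockNorm g (X → ι → ℝ)).loc_nonneg y f)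
    fun q hq => ?_
  have hx : q.1 ∈ fibre blk y := (mem_fibre blk y q.1).2 hq
  calc |f q.1 q.2| = ‖f q.1 q.2‖ := (Real.norm_eq_abs _).symm
    _ ≤ ‖f q.1‖ := norm_le_pi_norm (f q.1) q.2
    _ ≤ _ := norm_apply_le_loc hx f

/-- THE LOCAL SIZES AGREE (≥): the sharp sup size of `‖f x‖_∞` over the block is at most the block sup of `|f(x)(i)|` over `(x, i)`. [folklore] -/
theorem loc_supSize_le_loc_ofBlocks (y : g.Site) (f : X → ι → ℝ) :
    (supSize g (fibre blk) blk : BlockNorm g (X → ι → ℝ)).loc y f ≤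
      (BlockNorm.ofBlocks g (liftBlk blk ι)).loc y (fun q : X × ι => f q.1 q.2) := by
  refine loc_le_of_forall ((BlockNorm.ofBlocks g (liftBlk blk ι)).loc_nonneg y _) fun x hx => ?_
  have hxy : blk x = y := (mem_fibre blk y x).1 hx
  refine (pi_norm_le_iff_of_nonneg ((BlockNorm.ofBlocks g (liftBlk blk ι)).loc_nonneg y _)).2 fun i => ?_
  rw [Real.norm_eq_abs]
  exact abs_le_loc_ofBlocks (liftBlk blk ι) (fun q : X × ι => f q.1 q.2) (x' := (x, i)) hxy

/-- The two local sizes are EQUAL. [folklore] -/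
theorem loc_supSize_eq_loc_ofBlocks (y : g.Site) (f : X → ι → ℝ) :
    (supSize g (fibre blk) blk : BlockNorm g (X → ι → ℝ)).loc y f =
      (BlockNorm.ofBlocks g (liftBlk blk ι)).loc y (fun q : X × ι => f q.1 q.2) :=
  le_antisymm (loc_supSize_le_loc_ofBlocks blk y f) (loc_ofBlocks_uncurry_le blk y f)

variable {X₂ : Type} [Fintype X₂] (blk₂ : X₂ → g.Site)

/-- **MAJORANTS TRANSFER BOTH WAYS UNDER UNCURRYING** (`E = ℝ^ι`, same kernel, no constant): a linear map `T` between `ℝ^ι`-valued fields has the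
majorant `K` between the sharp sup sizes of 13c iff its uncurried form has it between the sharp block norms of 14. [folklore] -/
theorem hasMaj_ofBlocks_iff_hasMaj_supSize (T : (X → ι → ℝ) →ₗ[ℝ] (X₂ → ι → ℝ)) (K : g.Site → g.Site → ℝ) :
    HasMaj (BlockNorm.ofBlocks g (liftBlk blk ι)) (BlockNorm.ofBlocks g (liftBlk blk₂ ι))
        ((LinearEquiv.curry ℝ ℝ X₂ ι).symm.toLinearMap ∘ₗ T ∘ₗ (LinearEquiv.curry ℝ ℝ X ι).toLinearMap) K ↔
      HasMaj (supSize g (fibre blk) blk : BlockNorm g (X → ι → ℝ)) (supSize g (fibre blk₂) blk₂ : BlockNorm g (X₂ → ι → ℝ)) T K := by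
  constructor
  · intro h y' μ hμ y
    have hμ' : (BlockNorm.ofBlocks g (liftBlk blk ι)).IsLoc y' (fun q : X × ι => μ q.1 q.2) :=
      (isLoc_supSize_iff_isLoc_ofBlocks blk y' μ).1 hμ
    have key := h y' (fun q : X × ι => μ q.1 q.2) hμ' y
    have hcur : (LinearEquiv.curry ℝ ℝ X ι) (fun q : X × ι => μ q.1 q.2) = μ := rfl
    simp only [LinearMap.comp_apply, LinearEquiv.coe_toLinearMap, hcur] at key
    rw [loc_supSize_eq_loc_ofBlocks blk₂ y (T μ), loc_supSize_eq_loc_ofBlocks blk y' μ]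
    exact key
  · intro h y' ν hν y
    set μ : X → ι → ℝ := fun x i => ν (x, i) with hμ
    have hνμ : (fun q : X × ι => μ q.1 q.2) = ν := funext fun q => rfl
    have hμloc : (supSize g (fibre blk) blk : BlockNorm g (X → ι → ℝ)).IsLoc y' μ :=
      (isLoc_supSize_iff_isLoc_ofBlocks blk y' μ).2 (by rw [hνμ]; exact hν)
    have key := h y' μ hμloc y
    rw [loc_supSize_eq_loc_ofBlocks blk₂ y (T μ), loc_supSize_eq_loc_ofBlocks blk y' μ, hνμ] at key
    have hcur : (LinearEquiv.curry ℝ ℝ X ι) ν = μ := rfl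
    simp only [LinearMap.comp_apply, LinearEquiv.coe_toLinearMap, hcur]
    exact key

end Uncurry

end Summit.QuantumFields.YangMills.BalabanUVNodes.N15.MatrixSpecies
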